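import Literature.MathematicalPhysics.QuantumFieldTheory.King1986.UniformDecay
import Literature.MathematicalPhysics.QuantumFieldTheory.Balaban1983to89.B4Thm110ZeroTorus
import HarnessLib

/-!
# The BRIDGE from King's torus minimiser (`EffectiveLaplacianSymbol`) to Bałaban's `a_KG_K(T_ε,0)Q_K^*` of the B1/B4 tower
# (`B1RG242Torus`), and King's THEOREM 3.3 input for Prop. 3.8: uniform exponential decay of `a_kG_kQ_k^*` from [Ba 4] (1.10)

**Citation header (reproduction of PUBLISHED work; seat `pub-ymgap-dag-n18-b` of the cell `pub-ymgap`, Track-A node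
N18 = NE5 whose PRINTED MODEL of record is King's Prop. 3.8; sixth file of the seat's programme — it supplies the one
input which `King1986/MinimizerTwoSpacing.king_prop38_torus_of_decay` takes as a hypothesis: King p. 674 «combining our
bounds with Theorem 3.3 we deduce (3.71)», Theorem 3.3 being quoted from [Ba 4] = Bałaban, *Regularity and decay of
lattice Green's functions*, CMP **89** (1983), whose zero-field torus form (1.10) the lit-balaban cell PROVED for the
concrete scalar tower (`B4Thm110ZeroTorus.thm110_zero_torus`, `B1RG242Torus.tower`).  This file is the DICTIONARY between
the two formalisations of the same `A = 0` operators and the transported decay theorem; no new estimate.)**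
C. King, *The U(1) Higgs model. I. The continuum limit*, Commun. Math. Phys. **102** (1986) 649–677 [King1986], §2
(2.13)–(2.15) p. 653 (`T_{a,L^k}`, `a_k`, the minimiser), §3 Theorem 3.3 p. 658 / Prop. 3.7 p. 663 (uniform bounds «see
[Ba 4]»), §4 p. 670 «By using multiple reflection representations, the propagators G^η_k and G^η_k(Ω) can be written in
terms of the operator defined by (2.13) with free boundary conditions (and A = 0, of course) … (see [Ba 4])».
T. Bałaban, *(Higgs)₂,₃ quantum fields in a finite volume. I*, Commun. Math. Phys. **85** (1982) 603–636
[Balaban1982Higgs1], (2.11) p. 609 (`Q_k`), (2.13)/(2.15) p. 609 (`a_k`), (2.20) p. 610 (`G^ε_k = (−Δ^ε + m² +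
a_k(L^kε)^{−2}P_k)^{−1}`); T. Bałaban, *Regularity and decay of lattice Green's functions*, Commun. Math. Phys. **89**
(1983) 571–597 [Balaban1983RegularityDecay], (1.6) p. 572, Theorem (1.10) p. 573 «|(G_k(Ω, A)f)(x)| ≦ c₀ exp(−δ₀
dist(x, supp f))‖f‖_∞».

**What this file PROVES (kernel).**  For a volume `P = (d, L, m, K)` of `Setup` (fine torus `T_ε = Site P 0`,
`ε = L^{−K}`, unit torus `T^{(K)} = Site P K` with `2L^m` sites per direction) and King's tori `Tor (fine (L^K) M)`,
`Tor M` with `M_μ = 2L^m` (hypothesis `hMK`):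
* §1 the site dictionaries `toTor : T_ε ≃ Tor (fine L^K M)`, `toTorUnit : T^{(K)} ≃ Tor M` (coordinatewise
  `ZMod.ringEquivCongr`; labels preserved; lattice steps preserved, `toTor_shift`/`toTor_unshift`; BLOCKS CORRESPOND,
  `blockOf_toTor : blockOf (toTor x) = toTorUnit (proj K K x)`).
* §2 the OPERATORS CORRESPOND: `lapF_mulVec_apply` ∕ `hOp_mulVec_apply` (the same nearest-neighbour stencil),
  `fineOp_mulVec_toTor`, `fineOp_eq_reindex` (`A₀ = c(−Δ) + m² + aQ*Q` with `c = ε⁻²` IS the re-indexed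
  `−Δ^ε + m² + aP_K`), `tower_G_K` (`G_K(T_ε,0) = (−Δ^ε + m² + a_KP_K)⁻¹`, `L^Kε = 1`), `fineOp_inv_toTor_toTor`
  (`A₀⁻¹(toTor x, toTor y) = G_K(x, y)`, `Matrix.inv_reindex`), and **`minimiser_toTor_eq`**: King's minimiser kernel IS
  Bałaban's, `ℋ_K(toTor x, toTorUnit b) = a_K·(G_K(T_ε,0)Q_K^*δ_b)(x)` (`ℋ_K = minimiser (L^K) M a_K (ε⁻²) m² δ_b`,
  `a_K = B1.aSeq a L K`).
* §3 **`minimiser_kernel_decay`** = King's Theorem 3.3 / [Ba 4] (1.10) FOR `ℋ_K`, uniformly in the volume: for `d ≥ 1`,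
  odd `L > 1`, `a > 0`, `m² ≥ 0` there are `δ₀, c₀ > 0` with `|ℋ_K(toTor x, toTorUnit b)| ≤ a_K·c₀·e^{−δ₀·εD}` for every
  volume `(K ≥ 1)`, every `x`, `b` and every `D` below the fine sup-torus distances from `x` to the block of `b`
  (`thm110_zero_torus` with `f = Q_K^*δ_b`, `‖f‖_∞ = 1`).

**NOT COVERED.**  The derivative clause of (1.10) for `ℋ_K` (available from the same source, not transported here);
unit tori other than Bałaban's `2L^m` (King's (3.71) sup-rate `king_prop38_torus` holds for every `M`; the decay is
certified in the tree for these volumes); the identification `B1.aSeq = EffectiveLaplacianRate.aK` (both are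
`a(1 − L⁻²)/(1 − L^{−2k})`, needed only when the two files are combined — sequel); `A ≠ 0`.  HONEST FRAMING: a
dictionary between two typings of the same printed `A = 0` scalar operators on a finite torus + a transported theorem of
the lit-balaban cell; template-literature service for the NE5 printed model; nothing about Bałaban's covariant objects;
nothing continuum ∕ mass-gap ∕ Clay; count-neutral for the cell's 27 nodes.
-/

noncomputable section

open Finset Real Matrix
open scoped BigOperators

namespace Literature.MathematicalPhysics.QuantumFieldTheory.King1986

open Literature.MathematicalPhysics.QuantumFieldTheory.Balaban1983to89 (Params)
open Literature.MathematicalPhysics.QuantumFieldTheory.Balaban1983to89.B5Prop11Plancherel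
open Literature.MathematicalPhysics.QuantumFieldTheory.Balaban1983to89.B1RG242Torus (lvl lvl_of_le sitesPerDir_zero_eq tower Qks Qk extMat avgMat hOp hOp_mulVec deriv_mulVec extMat_mulVec avgMat_mulVec)

namespace Torus

variable {d : ℕ}

/-! ## §1 The site dictionaries `T_ε ≃ Tor (fine L^K M)`, `T^{(K)} ≃ Tor M` -/

section Equivs

variable (P : Params) (M : Fin P.d → ℕ) [hM : ∀ μ, NeZero (M μ)]

omit hM in
/-- The fine torus of the volume `P` has `L^K·M_μ` sites per direction (`M_μ = 2L^m` the unit torus; B12 (0.1): `T_η` with `L_μ = L^m`). [cite: Balaban1987RG1, (0.1) p.251] -/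
theorem sitesPerDir_zero_eq_fine (hMK : ∀ μ, M μ = P.sitesPerDir P.K) (μ : Fin P.d) : P.sitesPerDir 0 = fine (P.L ^ P.K) M μ := by
  have h := sitesPerDir_zero_eq P P.K
  rw [lvl_of_le P (Nat.le_add_left _ _)] at h
  rw [h]
  show P.L ^ P.K * P.sitesPerDir P.K = P.L ^ P.K * M μ
  rw [hMK μ]

/-- The fine-site dictionary `T_ε → Tor (fine L^K M)` (coordinatewise `ZMod.ringEquivCongr`). [folklore] -/
def toTor (hMK : ∀ μ, M μ = P.sitesPerDir P.K) (x : Balaban1983to89.Site P 0) : Tor (fine (P.L ^ P.K) M) :=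
  fun μ => ZMod.ringEquivCongr (sitesPerDir_zero_eq_fine P M hMK μ) (x μ)

/-- The unit-site dictionary `T^{(K)} → Tor M`. [folklore] -/
def toTorUnit (hMK : ∀ μ, M μ = P.sitesPerDir P.K) (b : Balaban1983to89.Site P P.K) : Tor M :=
  fun μ => ZMod.ringEquivCongr (hMK μ).symm (b μ)

/-- `toTor` as an equivalence. [folklore] -/
def torEquiv (hMK : ∀ μ, M μ = P.sitesPerDir P.K) : Balaban1983to89.Site P 0 ≃ Tor (fine (P.L ^ P.K) M) where
  toFun := toTor P M hMK
  invFun := fun y μ => (ZMod.ringEquivCongr (sitesPerDir_zero_eq_fine P M hMK μ)).symm (y μ)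
  left_inv := fun x => by funext μ; exact (ZMod.ringEquivCongr _).symm_apply_apply (x μ)
  right_inv := fun y => by funext μ; exact (ZMod.ringEquivCongr _).apply_symm_apply (y μ)

/-- `toTorUnit` as an equivalence. [folklore] -/
def torUnitEquiv (hMK : ∀ μ, M μ = P.sitesPerDir P.K) : Balaban1983to89.Site P P.K ≃ Tor M where
  toFun := toTorUnit P M hMK
  invFun := fun c μ => (ZMod.ringEquivCongr (hMK μ).symm).symm (c μ)
  left_inv := fun b => by funext μ; exact (ZMod.ringEquivCongr _).symm_apply_apply (b μ)
  right_inv := fun c => by funext μ; exact (ZMod.ringEquivCongr _).apply_symm_apply (c μ)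

omit hM in
/-- `toTor` is injective (the two typings of `T_ε` are in bijection). [cite: Balaban1987RG1, (0.1) p.251] -/
theorem toTor_injective (hMK : ∀ μ, M μ = P.sitesPerDir P.K) : Function.Injective (toTor P M hMK) :=
  (torEquiv P M hMK).injective

omit hM in
/-- `toTorUnit` is injective. [cite: Balaban1987RG1, (0.1) p.251] -/
theorem toTorUnit_injective (hMK : ∀ μ, M μ = P.sitesPerDir P.K) : Function.Injective (toTorUnit P M hMK) :=
  (torUnitEquiv P M hMK).injective

omit hM in
/-- The dictionary preserves labels. [cite: Balaban1987RG1, (0.1) p.251] -/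
theorem val_toTor (hMK : ∀ μ, M μ = P.sitesPerDir P.K) (x : Balaban1983to89.Site P 0) (μ : Fin P.d) : (toTor P M hMK x μ).val = (x μ).val := by
  simp only [toTor, ZMod.ringEquivCongr_val]

omit hM in
/-- The unit dictionary preserves labels. [cite: Balaban1987RG1, (0.1) p.251] -/
theorem val_toTorUnit (hMK : ∀ μ, M μ = P.sitesPerDir P.K) (b : Balaban1983to89.Site P P.K) (μ : Fin P.d) : (toTorUnit P M hMK b μ).val = (b μ).val := by
  simp only [toTorUnit, ZMod.ringEquivCongr_val]

omit hM in
/-- A lattice step is a lattice step: `toTor (x + e_μ) = toTor x + e_μ` (B1 (1.4): `b_± = x ± e_μ`). [cite: Balaban1982Higgs1, (1.4) p.604] -/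
theorem toTor_shift (hMK : ∀ μ, M μ = P.sitesPerDir P.K) (x : Balaban1983to89.Site P 0) (μ : Fin P.d) :
    toTor P M hMK (Balaban1983to89.Site.shift x μ) = toTor P M hMK x + unitVec (fine (P.L ^ P.K) M) μ := by
  funext ν
  simp only [toTor, Balaban1983to89.Site.shift, unitVec, Pi.add_apply]
  by_cases h : ν = μ
  · subst h
    rw [Function.update_self, Pi.single_eq_same, map_add, map_one]
  · rw [Function.update_of_ne h, Pi.single_eq_of_ne h, add_zero]

/-- The label of the block of a fine site is the label divided by `N` (B1 (1.17): `B(y) = {x : y_μ ≦ x_μ < y_μ + Lη}`, iterated, (1.20)). [cite: Balaban1982Higgs1, (1.17) p.606] -/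
theorem val_blockOf {N : ℕ} [NeZero N] {M' : Fin d → ℕ} [∀ μ, NeZero (M' μ)] (y : Tor (fine N M')) (μ : Fin d) :
    (blockOf N M' y μ).val = (y μ).val / N := by
  obtain ⟨j, hj⟩ := exists_eq_site (N := N) (M := M') y
  have hN : 0 < N := Nat.pos_of_ne_zero (NeZero.ne N)
  conv_rhs => rw [hj, val_site]
  rw [hj, blockOf_site]
  have hlt : (j μ : ℕ) < N := (j μ).isLt
  rw [Nat.add_comm, Nat.add_mul_div_left _ _ hN, Nat.div_eq_of_lt hlt, Nat.zero_add]

/-- **Blocks correspond**: the `L^K`-block of `toTor x` is the image of `proj K K x` (the unit site `y` with `x ∈ B^K(y)`, B1 (1.20)/(2.2)). [cite: Balaban1982Higgs1, (1.20) p.607] -/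
theorem blockOf_toTor (hMK : ∀ μ, M μ = P.sitesPerDir P.K) (x : Balaban1983to89.Site P 0) :
    blockOf (P.L ^ P.K) M (toTor P M hMK x) = toTorUnit P M hMK (Balaban1983to89.Site.proj P.K P.K x) := by
  funext μ
  apply ZMod.val_injective
  rw [val_blockOf, val_toTor, val_toTorUnit,
    Balaban1983to89.Site.val_proj (sitesPerDir_zero_eq P P.K |>.trans (by rw [lvl_of_le P (Nat.le_add_left _ _)])) x μ]

omit hM in
/-- `(x − e_μ) + e_μ = x`. [folklore] -/
private theorem shift_unshift' (x : Balaban1983to89.Site P 0) (μ : Fin P.d) :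
    Balaban1983to89.Site.shift (Balaban1983to89.Site.unshift x μ) μ = x := by
  funext ν
  simp only [Balaban1983to89.Site.shift, Balaban1983to89.Site.unshift]
  by_cases h : ν = μ
  · subst h; simp
  · simp [Function.update_of_ne h]

omit hM in
/-- `(x + e_μ) − e_μ = x`. [folklore] -/
private theorem unshift_shift' (x : Balaban1983to89.Site P 0) (μ : Fin P.d) :
    Balaban1983to89.Site.unshift (Balaban1983to89.Site.shift x μ) μ = x := by
  funext ν
  simp only [Balaban1983to89.Site.shift, Balaban1983to89.Site.unshift]
  by_cases h : ν = μ
  · subst h; simp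
  · simp [Function.update_of_ne h]

omit hM in
/-- A backward lattice step is a backward lattice step (`b_− = x − e_μ`). [cite: Balaban1982Higgs1, (1.4) p.604] -/
theorem toTor_unshift (hMK : ∀ μ, M μ = P.sitesPerDir P.K) (x : Balaban1983to89.Site P 0) (μ : Fin P.d) :
    toTor P M hMK (Balaban1983to89.Site.unshift x μ) = toTor P M hMK x - unitVec (fine (P.L ^ P.K) M) μ := by
  rw [eq_sub_iff_add_eq, ← toTor_shift, shift_unshift']

end Equivs

/-! ## §2 The operators correspond: `c(−Δ) + m² + aQ*Q` on `Tor (fine L^K M)` IS `−Δ^ε + m² + a_KP_K` on `T_ε` -/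

section Operators

variable (P : Params) (M : Fin P.d → ℕ) [hM : ∀ μ, NeZero (M μ)]

/-- The action of King's fine operator `c(−Δ) + m²` on a field: the lattice Laplacian stencil.
[cite: King1986, (4.4) p.670] -/
theorem lapF_mulVec_apply {dd : ℕ} (Kt : Fin dd → ℕ) [∀ μ, NeZero (Kt μ)] (c m2 : ℝ) (g : Tor Kt → ℝ) (z : Tor Kt) :
    (lapF Kt c m2 *ᵥ g) z = (m2 + 2 * dd * c) * g z - c * ∑ μ, (g (z + unitVec Kt μ) + g (z - unitVec Kt μ)) := by
  have hexp : (lapF Kt c m2 *ᵥ g) z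
      = ∑ z', ((m2 + 2 * dd * c) * (if z' = z then 1 else 0)
          - c * ∑ μ, ((if z' = z + unitVec Kt μ then 1 else 0) + (if z' = z - unitVec Kt μ then 1 else 0))) * g z' := by
    simp only [Matrix.mulVec, dotProduct, lapF]
  have hA : ∑ z', ((m2 + 2 * dd * c) * (if z' = z then (1 : ℝ) else 0)) * g z' = (m2 + 2 * dd * c) * g z := by
    simp_rw [mul_assoc, boole_mul]
    rw [← Finset.mul_sum, Finset.sum_ite_eq' Finset.univ z, if_pos (Finset.mem_univ _)]
  have hB : ∑ z', (c * ∑ μ, ((if z' = z + unitVec Kt μ then (1 : ℝ) else 0)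
        + (if z' = z - unitVec Kt μ then (1 : ℝ) else 0))) * g z'
      = c * ∑ μ, (g (z + unitVec Kt μ) + g (z - unitVec Kt μ)) := by
    simp_rw [mul_assoc, Finset.sum_mul, add_mul, boole_mul]
    rw [← Finset.mul_sum, Finset.sum_comm]
    congr 1
    refine Finset.sum_congr rfl fun μ _ => ?_
    rw [Finset.sum_add_distrib, Finset.sum_ite_eq' Finset.univ, Finset.sum_ite_eq' Finset.univ,
      if_pos (Finset.mem_univ _), if_pos (Finset.mem_univ _)]
  rw [hexp]
  simp_rw [sub_mul]
  rw [Finset.sum_sub_distrib, hA, hB]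

/-- The action of the tower's `−Δ^s + m²` (`hOp`) on a field: the same stencil with `c = s⁻²`.
[cite: Balaban1982Higgs1, (1.11) p.605] -/
theorem hOp_mulVec_apply (s msq : ℝ) (f : Balaban1983to89.Site P 0 → ℝ) (x : Balaban1983to89.Site P 0) :
    (hOp P 0 s msq *ᵥ f) x
      = msq * f x + (s⁻¹) ^ 2 * ∑ μ, (2 * f x - f (Balaban1983to89.Site.shift x μ)
          - f (Balaban1983to89.Site.unshift x μ)) := by
  rw [hOp_mulVec, Pi.add_apply, Pi.smul_apply, smul_eq_mul, Finset.sum_apply, Finset.mul_sum]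
  congr 1
  refine Finset.sum_congr rfl fun μ _ => ?_
  -- `(∂ᵀ g)(x) = s⁻¹ (g(x − e_μ) − g x)`
  have htr : ∀ g : Balaban1983to89.Site P 0 → ℝ,
      ((Balaban1983to89.B1RG242Torus.deriv P 0 s μ)ᵀ *ᵥ g) x = s⁻¹ * (g (Balaban1983to89.Site.unshift x μ) - g x) := by
    intro g
    simp only [Matrix.mulVec, dotProduct, Matrix.transpose_apply, Balaban1983to89.B1RG242Torus.deriv,
      Balaban1983to89.B1RG242Torus.shiftMat, Matrix.smul_apply, Matrix.sub_apply, Matrix.one_apply, smul_eq_mul]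
    simp_rw [mul_sub, sub_mul]
    rw [Finset.sum_sub_distrib]
    have h1 : ∑ z, s⁻¹ * (if x = Balaban1983to89.Site.shift z μ then (1 : ℝ) else 0) * g z
        = s⁻¹ * g (Balaban1983to89.Site.unshift x μ) := by
      have hiff : ∀ z, (x = Balaban1983to89.Site.shift z μ) ↔ (Balaban1983to89.Site.unshift x μ = z) := by
        intro z; constructor
        · intro h; rw [h, unshift_shift']
        · intro h; rw [← h, shift_unshift']
      simp_rw [hiff, mul_ite, mul_one, mul_zero, ite_mul, zero_mul, Finset.sum_ite_eq, Finset.mem_univ, if_true]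
    have h2 : ∑ z, s⁻¹ * (if z = x then (1 : ℝ) else 0) * g z = s⁻¹ * g x := by
      simp_rw [mul_ite, mul_one, mul_zero, ite_mul, zero_mul, Finset.sum_ite_eq', Finset.mem_univ, if_true]
    rw [h1, h2]
  rw [htr, deriv_mulVec, deriv_mulVec, shift_unshift']
  ring

/-- `lvl K = K`. [folklore] -/
private theorem lvl_K : lvl P P.K = P.K := lvl_of_le P (Nat.le_add_left _ _)

/-- The tower's averaging weight at level `K` is `N^{−d}`, `N = L^K`. [folklore] -/
private theorem weight_K :
    ((((P.L : ℝ) ^ P.d)⁻¹) ^ lvl P P.K) = ((((P.L ^ P.K : ℕ) : ℝ)) ^ P.d)⁻¹ := by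
  rw [lvl_K, inv_pow, ← pow_mul, Nat.cast_pow, ← pow_mul, Nat.mul_comm]

/-- **THE OPERATORS CORRESPOND**: King's `A₀ = ε⁻²(−Δ) + m² + aQ*Q` acting on a field of the fine torus, read at
`toTor x`, is the tower's `(−Δ^ε + m² + aP_K)` acting on the pulled-back field, read at `x`.
[cite: Balaban1982Higgs1, (2.20) p.610; King1986, (2.13) p.653] -/
theorem fineOp_mulVec_toTor (hMK : ∀ μ, M μ = P.sitesPerDir P.K) (a m2 : ℝ)
    (g : Tor (fine (P.L ^ P.K) M) → ℝ) (x : Balaban1983to89.Site P 0) :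
    (fineOp (P.L ^ P.K) M a ((P.eps⁻¹) ^ 2) m2 *ᵥ g) (toTor P M hMK x)
      = ((hOp P 0 P.eps m2 + a • (Qks P P.K * Qk P P.K)) *ᵥ (g ∘ toTor P M hMK)) x := by
  rw [fineOp, Matrix.add_mulVec, Matrix.add_mulVec, Pi.add_apply, Pi.add_apply, Matrix.smul_mulVec,
    Matrix.smul_mulVec, Pi.smul_apply, Pi.smul_apply, smul_eq_mul, smul_eq_mul]
  congr 1
  · -- Laplacian part
    rw [lapF_mulVec_apply, hOp_mulVec_apply]
    simp only [Function.comp_apply, toTor_shift, toTor_unshift]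
    have hsum : ∑ μ : Fin P.d, (2 * g (toTor P M hMK x) - g (toTor P M hMK x + unitVec (fine (P.L ^ P.K) M) μ)
          - g (toTor P M hMK x - unitVec (fine (P.L ^ P.K) M) μ))
        = 2 * (P.d : ℝ) * g (toTor P M hMK x)
          - ∑ μ : Fin P.d, (g (toTor P M hMK x + unitVec (fine (P.L ^ P.K) M) μ)
            + g (toTor P M hMK x - unitVec (fine (P.L ^ P.K) M) μ)) := by
      rw [show (fun μ : Fin P.d => 2 * g (toTor P M hMK x) - g (toTor P M hMK x + unitVec (fine (P.L ^ P.K) M) μ)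
          - g (toTor P M hMK x - unitVec (fine (P.L ^ P.K) M) μ))
          = (fun μ => 2 * g (toTor P M hMK x) - (g (toTor P M hMK x + unitVec (fine (P.L ^ P.K) M) μ)
          + g (toTor P M hMK x - unitVec (fine (P.L ^ P.K) M) μ))) from funext fun μ => by ring,
        Finset.sum_sub_distrib, Finset.sum_const, Finset.card_univ, Fintype.card_fin, nsmul_eq_mul]
      ring
    rw [hsum]
    ring
  · -- block-averaging part
    congr 1
    simp only [Qks, Qk]
    rw [← Matrix.mulVec_mulVec, extMat_mulVec, avgMat_mulVec, weight_K, lvl_K]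
    simp only [Matrix.mulVec, dotProduct, blockProj, Function.comp_apply]
    rw [← (torEquiv P M hMK).sum_comp]
    refine Finset.sum_congr rfl fun y _ => ?_
    have hb : (blockOf (P.L ^ P.K) M (toTor P M hMK x) = blockOf (P.L ^ P.K) M (toTor P M hMK y))
        ↔ (Balaban1983to89.Site.proj P.K P.K y = Balaban1983to89.Site.proj P.K P.K x) := by
      rw [blockOf_toTor, blockOf_toTor, eq_comm]
      exact (toTorUnit_injective P M hMK).eq_iff
    show (if blockOf (P.L ^ P.K) M (toTor P M hMK x) = blockOf (P.L ^ P.K) M (toTor P M hMK y)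
        then ((((P.L ^ P.K : ℕ) : ℝ)) ^ P.d)⁻¹ else 0) * g (toTor P M hMK y) = _
    simp only [hb]
    split_ifs <;> simp

/-- Entrywise: `A₀(toTor x, toTor y) = (−Δ^ε + m² + aP_K)(x, y)`. [cite: Balaban1982Higgs1, (2.20) p.610] -/
theorem fineOp_toTor_toTor (hMK : ∀ μ, M μ = P.sitesPerDir P.K) (a m2 : ℝ) (x y : Balaban1983to89.Site P 0) :
    fineOp (P.L ^ P.K) M a ((P.eps⁻¹) ^ 2) m2 (toTor P M hMK x) (toTor P M hMK y)
      = (hOp P 0 P.eps m2 + a • (Qks P P.K * Qk P P.K)) x y := by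
  have h := fineOp_mulVec_toTor P M hMK a m2 (Pi.single (toTor P M hMK y) 1) x
  rw [Matrix.mulVec_single_one] at h
  have hcomp : (Pi.single (toTor P M hMK y) (1 : ℝ)) ∘ toTor P M hMK = Pi.single y 1 := by
    funext z
    simp only [Function.comp_apply, Pi.single_apply, (toTor_injective P M hMK).eq_iff]
  rw [hcomp, Matrix.mulVec_single_one] at h
  exact h

/-- `A₀` is the re-indexed tower operator. [cite: Balaban1982Higgs1, (2.20) p.610] -/
theorem fineOp_eq_reindex (hMK : ∀ μ, M μ = P.sitesPerDir P.K) (a m2 : ℝ) :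
    fineOp (P.L ^ P.K) M a ((P.eps⁻¹) ^ 2) m2
      = Matrix.reindex (torEquiv P M hMK) (torEquiv P M hMK) (hOp P 0 P.eps m2 + a • (Qks P P.K * Qk P P.K)) := by
  ext i j
  rw [Matrix.reindex_apply, Matrix.submatrix_apply]
  obtain ⟨x, rfl⟩ := (torEquiv P M hMK).surjective i
  obtain ⟨y, rfl⟩ := (torEquiv P M hMK).surjective j
  rw [Equiv.symm_apply_apply, Equiv.symm_apply_apply]
  exact fineOp_toTor_toTor P M hMK a m2 x y

/-- The tower's `G_K(T_ε, 0) = (−Δ^ε + m² + a_K P_K)⁻¹` at the top level (`L^Kε = 1`, `a_K = aSeq a L K`).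
[cite: Balaban1982Higgs1, (2.20) p.610; Balaban1983RegularityDecay, (1.6) p.572] -/
theorem tower_G_K (a msq : ℝ) :
    (tower P a msq).G P.K = (hOp P 0 P.eps msq + Balaban1983to89.B1.aSeq a P.L P.K • (Qks P P.K * Qk P P.K))⁻¹ := by
  show (Balaban1983to89.B1RG242Torus.H P msq + Balaban1983to89.B1RG242Torus.α P a P.K • (Qks P P.K * Qk P P.K))⁻¹ = _
  rw [Balaban1983to89.B1RG242Torus.H, Balaban1983to89.B1RG242Torus.α, Params.spacing_K, one_pow, inv_one, mul_one]

/-- **THE INVERSES CORRESPOND**: `A₀⁻¹(toTor x, toTor y) = G_K(T_ε, 0)(x, y)`. [cite: Balaban1983RegularityDecay, (1.6) p.572] -/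
theorem fineOp_inv_toTor_toTor (hMK : ∀ μ, M μ = P.sitesPerDir P.K) (a msq : ℝ) (x y : Balaban1983to89.Site P 0) :
    (fineOp (P.L ^ P.K) M (Balaban1983to89.B1.aSeq a P.L P.K) ((P.eps⁻¹) ^ 2) msq)⁻¹ (toTor P M hMK x) (toTor P M hMK y)
      = (tower P a msq).G P.K x y := by
  rw [fineOp_eq_reindex P M hMK, Matrix.inv_reindex, tower_G_K, Matrix.reindex_apply, Matrix.submatrix_apply]
  show _ = _
  rw [show (torEquiv P M hMK).symm (toTor P M hMK x) = x from (torEquiv P M hMK).symm_apply_apply x,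
    show (torEquiv P M hMK).symm (toTor P M hMK y) = y from (torEquiv P M hMK).symm_apply_apply y]

/-- **KING'S MINIMISER KERNEL IS BAŁABAN'S `a_KG_KQ_K^*`**: with `N = L^K`, `c = ε⁻²`, `a = a_K`,
`ℋ(toTor x, toTorUnit b) = a_K·(G_K(T_ε,0) Q_K^* δ_b)(x)`. [cite: King1986, (2.13)–(2.15) p.653; Balaban1983RegularityDecay, (1.6) p.572] -/
theorem minimiser_toTor_eq (hMK : ∀ μ, M μ = P.sitesPerDir P.K) (a msq : ℝ) (b : Balaban1983to89.Site P P.K)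
    (x : Balaban1983to89.Site P 0) :
    minimiser (P.L ^ P.K) M (Balaban1983to89.B1.aSeq a P.L P.K) ((P.eps⁻¹) ^ 2) msq
        (Pi.single (toTorUnit P M hMK b) 1) (toTor P M hMK x)
      = Balaban1983to89.B1.aSeq a P.L P.K * ((tower P a msq).G P.K *ᵥ (Qks P P.K *ᵥ Pi.single b 1)) x := by
  have hN : ((((P.L ^ P.K : ℕ) : ℝ)) ^ P.d) ≠ 0 :=
    pow_ne_zero _ (by exact_mod_cast pow_ne_zero _ (by have := P.hL.2; omega))
  -- the two source vectors as explicit functions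
  have hv : (Qmat (P.L ^ P.K) M)ᵀ *ᵥ Pi.single (toTorUnit P M hMK b) (1 : ℝ)
      = fun z => ((((P.L ^ P.K : ℕ) : ℝ)) ^ P.d)⁻¹ * (Pi.single (toTorUnit P M hMK b) (1 : ℝ) : Tor M → ℝ) (blockOf (P.L ^ P.K) M z) := by
    funext z; rw [transpose_Qmat_mulVec, Nat.cast_pow]
  have hw : Qks P P.K *ᵥ Pi.single b (1 : ℝ)
      = fun y => (Pi.single b (1 : ℝ) : Balaban1983to89.Site P P.K → ℝ) (Balaban1983to89.Site.proj P.K P.K y) := by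
    funext y; simp only [Qks]; rw [extMat_mulVec, lvl_K]
  have hind : ∀ y : Balaban1983to89.Site P 0,
      (Pi.single (toTorUnit P M hMK b) (1 : ℝ) : Tor M → ℝ) (toTorUnit P M hMK (Balaban1983to89.Site.proj P.K P.K y))
        = (Pi.single b (1 : ℝ) : Balaban1983to89.Site P P.K → ℝ) (Balaban1983to89.Site.proj P.K P.K y) := by
    intro y
    simp only [Pi.single_apply, (toTorUnit_injective P M hMK).eq_iff]
  rw [minimiser, Pi.smul_apply, smul_eq_mul, hv, hw]
  -- unfold the two outer matrix–vector products and re-index the fine sum through `toTor`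
  have hsum : ((fineOp (P.L ^ P.K) M (Balaban1983to89.B1.aSeq a P.L P.K) ((P.eps⁻¹) ^ 2) msq)⁻¹
        *ᵥ fun z => ((((P.L ^ P.K : ℕ) : ℝ)) ^ P.d)⁻¹
          * (Pi.single (toTorUnit P M hMK b) (1 : ℝ) : Tor M → ℝ) (blockOf (P.L ^ P.K) M z)) (toTor P M hMK x)
      = ((((P.L ^ P.K : ℕ) : ℝ)) ^ P.d)⁻¹
        * ((tower P a msq).G P.K *ᵥ fun y => (Pi.single b (1 : ℝ) : Balaban1983to89.Site P P.K → ℝ) (Balaban1983to89.Site.proj P.K P.K y)) x := by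
    simp only [Matrix.mulVec, dotProduct]
    rw [Finset.mul_sum, ← (torEquiv P M hMK).sum_comp]
    refine Finset.sum_congr rfl fun y _ => ?_
    change (fineOp (P.L ^ P.K) M (Balaban1983to89.B1.aSeq a P.L P.K) ((P.eps⁻¹) ^ 2) msq)⁻¹ (toTor P M hMK x)
        (toTor P M hMK y) * (((((P.L ^ P.K : ℕ) : ℝ)) ^ P.d)⁻¹
          * (Pi.single (toTorUnit P M hMK b) (1 : ℝ) : Tor M → ℝ) (blockOf (P.L ^ P.K) M (toTor P M hMK y))) = _
    rw [fineOp_inv_toTor_toTor P M hMK, blockOf_toTor, hind]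
    ring
  rw [hsum, Nat.cast_pow]
  have hN' : ((P.L : ℝ) ^ P.K) ^ P.d ≠ 0 :=
    pow_ne_zero _ (pow_ne_zero _ (by exact_mod_cast (show P.L ≠ 0 by have := P.hL.2; omega)))
  field_simp

end Operators

/-! ## §3 Hence B4's Theorem (1.10) gives the uniform exponential decay of King's minimiser kernel (Theorem 3.3's input) -/

section Decay

/-- **UNIFORM EXPONENTIAL DECAY OF KING'S MINIMISER KERNEL (King's Theorem 3.3 / Prop. 3.7 for `a_kG_kQ_k^*` at
`A = 0`, from [Ba 4] (1.10) on the torus as certified by the lit-balaban cell).**  For every dimension `d ≥ 1`, odd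
`L > 1`, `a > 0`, `m² ≥ 0` there are `δ₀, c₀ > 0` (functions of `d, L, a, m²` only) such that for EVERY volume
`P = (d, L, m, K)` with `K ≥ 1`, every unit torus `M_μ = 2L^m` of that volume, every fine point `x` and unit site `b`:
`|ℋ_K(toTor x, toTorUnit b)| ≤ a_K·c₀·exp(−δ₀·εD)` whenever `D ≤` the fine sup-torus distance from `x` to every point of
the block of `b` — i.e. decay `exp(−δ₀·dist(x, B(b)))` in physical (= unit-block) units, uniformly in the volume.  Here
`ℋ_K = minimiser (L^K) M a_K (ε⁻²) m²` is King's `a_KG^ε_KQ^*_K` (`EffectiveLaplacianSymbol`), `a_K = aSeq a L K`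
((2.13)/(2.15) of B1), and the input is `B4Thm110ZeroTorus.thm110_zero_torus` through the bridge `minimiser_toTor_eq`.
[cite: King1986, Theorem 3.3 p.658 and Prop. 3.7 p.663; Balaban1983RegularityDecay, Theorem (1.10) p.573] -/
theorem minimiser_kernel_decay (dd L : ℕ) (hd : 1 ≤ dd) (hL : Odd L ∧ 1 < L) {a : ℝ} (ha : 0 < a) {msq : ℝ}
    (hmsq : 0 ≤ msq) :
    ∃ δ₀ c₀ : ℝ, 0 < δ₀ ∧ 0 < c₀ ∧ ∀ (P : Params), P.d = dd → P.L = L → 1 ≤ P.K →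
      ∀ (M : Fin P.d → ℕ) [∀ μ, NeZero (M μ)] (hMK : ∀ μ, M μ = P.sitesPerDir P.K)
        (x : Balaban1983to89.Site P 0) (b : Balaban1983to89.Site P P.K) (D : ℝ), 0 ≤ D →
        (∀ z : Balaban1983to89.Site P 0, Balaban1983to89.Site.proj P.K P.K z = b →
          D ≤ Balaban1983to89.B5Ineq137Torus.T P 0 x z) →
        |minimiser (P.L ^ P.K) M (Balaban1983to89.B1.aSeq a P.L P.K) ((P.eps⁻¹) ^ 2) msq
            (Pi.single (toTorUnit P M hMK b) 1) (toTor P M hMK x)|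
          ≤ Balaban1983to89.B1.aSeq a P.L P.K * c₀ * Real.exp (-(δ₀ * (P.eps * D))) := by
  obtain ⟨δ₀, c₀, hδ₀, hc₀, H⟩ := Balaban1983to89.B4Thm110ZeroTorus.thm110_zero_torus dd L hd hL ha hmsq
  refine ⟨δ₀, c₀, hδ₀, hc₀, ?_⟩
  intro P hPd hPL hK M _ hMK x b D hD0 hD
  have hLr : (1 : ℝ) < P.L := by exact_mod_cast P.hL.2
  have haK : 0 < Balaban1983to89.B1.aSeq a P.L P.K := Balaban1983to89.B1.aSeq_pos ha hLr hK
  -- the source `f = Q_K^* δ_b` is the indicator of the block of `b`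
  have hf : ∀ z : Balaban1983to89.Site P 0,
      (Qks P P.K *ᵥ (Pi.single b (1 : ℝ) : Balaban1983to89.Site P P.K → ℝ)) z
        = if Balaban1983to89.Site.proj P.K P.K z = b then 1 else 0 := by
    intro z
    simp only [Qks]
    rw [extMat_mulVec, lvl_of_le P (Nat.le_add_left _ _), Pi.single_apply]
  have hF : ∀ z, |(Qks P P.K *ᵥ (Pi.single b (1 : ℝ) : Balaban1983to89.Site P P.K → ℝ)) z| ≤ 1 := by
    intro z; rw [hf z]; split_ifs <;> simp
  have hsupp : ∀ z, (Qks P P.K *ᵥ (Pi.single b (1 : ℝ) : Balaban1983to89.Site P P.K → ℝ)) z ≠ 0 →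
      D ≤ Balaban1983to89.B5Ineq137Torus.T P 0 x z := by
    intro z hz
    rw [hf z] at hz
    by_cases hb : Balaban1983to89.Site.proj P.K P.K z = b
    · exact hD z hb
    · rw [if_neg hb] at hz; exact absurd rfl hz
  have hmain := (H P hPd hPL P.K hK le_rfl x _ 1 D hF hD0 hsupp).1
  rw [minimiser_toTor_eq P M hMK, abs_mul, abs_of_pos haK, mul_assoc]
  refine mul_le_mul_of_nonneg_left ?_ haK.le
  simpa using hmain

end Decay

end Torus

end Literature.MathematicalPhysics.QuantumFieldTheory.King1986
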